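import Summits.QuantumFields.YangMills.Theorems.ToronValleyVolumeZeroModeDefs
import HarnessLib

/-!
# The Euler ∕ virial identity of the toron zero-mode block: `4β⟨Q_k⟩ + ⟨|c|²⟩ = 3k` — the central stratum is virial-SOFT
# (free-hands helper toward crux ⟨stmt-QuantumFields-24141⟩ `VirialFluxGap.PeriodicSoftness`; LEAD seat ym-line-sfw-p2 gen 92)

For the tree's zero-mode quartic `Q_k(c) = Σ_{μ<ν} ‖c_μ × c_ν‖²` on `(ℝ³)ᵏ` and its Gaussian-regularised Gibbs weight
`zmI k β c = exp(−β Q_k(c) − Σ_μ‖c_μ‖²/2)` (✓`ToronValleyVolumeZeroModeDefs`), HOMOGENEITY OF DEGREE 4 of `Q_k` gives the exact identity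

  `4β·∫ Q_k·zmI + ∫ (Σ_μ‖c_μ‖²)·zmI = 3k·Z_k(β)`   (`β ≥ 0`, every `k`; ★★ `zeroMode_virial`),

i.e. `β⟨Q_k⟩_β = 3k/4 − ¼⟨Σ‖c_μ‖²⟩_β < 3k/4`; for the periodic block `k = 4`: `β⟨Q₄⟩_β < 3` (★ `zeroMode_virial_four`).  Reading (memo
`Cruxes/PeriodicSoftness/…` ∕ evidence on ⟨24141⟩, «PeriodicSoftness by a global virial field»): in the integration-by-parts identity
`β⟨F₀⟩ = ⟨div X⟩ + β⟨F₀ − X(F₀)⟩` the weighted Euler field `X = ¼c·∂_c` on the 12 constant modes at a CENTRAL toron has `X(Q) = Q` exactly and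
`div X = 3` — the same `3 = 6·½` that the six soft Morse–Bott directions contribute at a generic toron — so the singular stratum of the toron valley costs
NOTHING for the ONE-SIDED bound the leaf asks (`β⟨F₀⟩ ≤ 9L⁴ − c`), whereas the two-sided state-density law (`stub_stateDensityLaw` of ⟨24497⟩) must resolve it
(RLCT `9L⁴ − 3/2` with multiplicity 2, one log).  This file is that mechanism on the zero-mode block alone, as a kernel theorem.

Proof: the scaling `c ↦ t·c` (`Q_k(tc) = t⁴Q_k(c)`, `|tc|² = t²|c|²`, Lebesgue measure on the `3k`-dimensional block scales by `t^{−3k}`: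
Mathlib `Measure.integral_comp_smul_of_nonneg`) gives `∫ exp(−βt⁴Q_k − t²|c|²/2) dc = t^{−3k}·Z_k(β)` for `t > 0`; differentiate at `t = 1` under the
integral sign (`hasDerivAt_integral_of_dominated_loc_of_deriv_le`, dominating function `32·exp(−|c|²/16)` on `t ∈ (1/2, 3/2)`) and compare with
`d/dt t^{−3k} = −3k`.  THEOREMS ONLY (no `def`, no `sorry`, default heartbeats).

HONEST LABEL: a toy ∕ BC5-type rung (the zero-mode block, not the ring measure); nothing of ⟨24141⟩ PeriodicSoftness, ⟨24497⟩ ToronTubeVolumeLaw, a rung,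
a leaf or a summit is proved here; the Yang–Mills mass gap is NOT proved by this; no summit is proved by a line.

References: S. Watanabe, Algebraic Geometry and Statistical Learning Theory (CUP 2009), Rem. 1.15 (real log-canonical thresholds of homogeneous
singularities) [doi:10.1017/cbo9780511800474]; A. Coste, A. González-Arroyo, J. Jurkiewicz, C.P. Korthals Altes, Nucl. Phys. B 262 (1985) 67 (the toron
valley and its quartic zero-mode potential) [CosteEtAl1985]; M. Creutz, Quarks, Gluons and Lattices (CUP, 2nd ed. 2022) p. 58 (equipartition ∕ virial
reading of mean actions) [Creutz2022].
-/

set_option autoImplicit false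

noncomputable section

namespace Summit.QuantumFields.YangMills.Theorems.ToronValleyVolume.ZeroMode

open MeasureTheory Real Finset Filter Topology Set
open Summit.QuantumFields.YangMills.Cruxes.ToronTubeVolumeLaw.Birth

/-! ## §1 Homogeneity of the block under `c ↦ t·c` -/

/-- `D(tu, tv) = t⁴·D(u, v)`. [folklore] -/
theorem pd_smul (t : ℝ) (u v : EuclideanSpace ℝ (Fin 3)) : pd (t • u) (t • v) = t ^ 4 * pd u v := by
  unfold pd
  rw [norm_smul, norm_smul, real_inner_smul_left, real_inner_smul_right, Real.norm_eq_abs, mul_pow, mul_pow, sq_abs]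
  ring

/-- `Q_k(t·c) = t⁴·Q_k(c)`: the zero-mode quartic is homogeneous of degree `4`. [folklore] -/
theorem quartic_smul (k : ℕ) (t : ℝ) (c : Fin k → EuclideanSpace ℝ (Fin 3)) :
    zeroModeQuartic k (t • c) = t ^ 4 * zeroModeQuartic k c := by
  simp only [quartic_eq_half_sum, Pi.smul_apply, pd_smul, ← Finset.mul_sum]
  ring

/-- `Σ_μ ‖(t·c)_μ‖² = t²·Σ_μ ‖c_μ‖²`. [folklore] -/
theorem normSum_smul (k : ℕ) (t : ℝ) (c : Fin k → EuclideanSpace ℝ (Fin 3)) :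
    (∑ μ, ‖(t • c) μ‖ ^ 2) = t ^ 2 * ∑ μ, ‖c μ‖ ^ 2 := by
  simp only [Pi.smul_apply, norm_smul, Real.norm_eq_abs, mul_pow, sq_abs, ← Finset.mul_sum]

/-- The scaled integrand: `zmI k β (t·c) = exp(−β·t⁴Q_k(c) − t²·Σ‖c_μ‖²/2)`. [folklore] -/
theorem zmI_smul (k : ℕ) (β t : ℝ) (c : Fin k → EuclideanSpace ℝ (Fin 3)) :
    zmI k β (t • c) = Real.exp (-β * (t ^ 4 * zeroModeQuartic k c) - t ^ 2 * (∑ μ, ‖c μ‖ ^ 2) / 2) := by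
  unfold zmI; rw [quartic_smul, normSum_smul]

/-! ## §2 The scaling identity `∫ zmI(t·c) dc = t^{−3k}·Z_k` -/

/-- The zero-mode block `(ℝ³)ᵏ` has dimension `3k`. [folklore] -/
theorem finrank_block (k : ℕ) : Module.finrank ℝ (Fin k → EuclideanSpace ℝ (Fin 3)) = 3 * k := by
  rw [Module.finrank_pi_fintype]
  simp only [finrank_euclideanSpace_fin, Finset.sum_const, Finset.card_univ, Fintype.card_fin, smul_eq_mul]
  ring

/-- ★ SCALING: `∫ zmI k β (t·c) dc = (t^{3k})⁻¹·Z_k(β)` for `t > 0` (Lebesgue measure on the `3k`-dimensional block). [folklore] -/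
theorem integral_zmI_smul (k : ℕ) (β : ℝ) {t : ℝ} (ht : 0 < t) :
    ∫ c : Fin k → EuclideanSpace ℝ (Fin 3), zmI k β (t • c) = (t ^ (3 * k))⁻¹ * zeroModeZ k β := by
  have h := MeasureTheory.Measure.integral_comp_smul_of_nonneg (μ := (volume : Measure (Fin k → EuclideanSpace ℝ (Fin 3))))
    (fun c : Fin k → EuclideanSpace ℝ (Fin 3) => zmI k β c) t (hR := ht.le)
  rw [finrank_block, smul_eq_mul] at h
  rw [zeroModeZ_eq_integral]
  exact h

/-! ## §3 Elementary bounds for the dominating function -/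

/-- `S·e^{−S/8} ≤ 16·e^{−S/16}` (for every real `S`). [folklore] -/
theorem mul_exp_neg_div_eight_le (S : ℝ) : S * Real.exp (-(S / 8)) ≤ 16 * Real.exp (-(S / 16)) := by
  -- `x·e^{−x} ≤ 1` at `x = S/16` (✓`Literature…SelbergDecay.mul_exp_neg_le_one` states this; re-derived in one line to keep the import cone small)
  have h1 : S / 16 * Real.exp (-(S / 16)) ≤ 1 := by
    have a := Real.add_one_le_exp (S / 16)
    rw [Real.exp_neg, mul_inv_le_iff₀ (Real.exp_pos _)]
    linarith
  have h2 : Real.exp (-(S / 8)) = Real.exp (-(S / 16)) * Real.exp (-(S / 16)) := by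
    rw [← Real.exp_add]; congr 1; ring
  have h3 : 0 < Real.exp (-(S / 16)) := Real.exp_pos _
  rw [h2]
  nlinarith [h1, h3]

/-- The Gaussian `exp(−‖x‖²/16)` is integrable on `ℝ³`. [folklore] -/
theorem integrable_exp_neg_normSq_sixteenth :
    Integrable fun x : EuclideanSpace ℝ (Fin 3) => Real.exp (-(‖x‖ ^ 2 / 16)) := by
  have h := GaussianFourier.integrable_cexp_neg_mul_sq_norm_add (V := EuclideanSpace ℝ (Fin 3)) (b := 1 / 16)
    (by norm_num) 0 0
  simp only [zero_mul, add_zero] at h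
  refine h.norm.congr (Filter.Eventually.of_forall fun x => ?_)
  simp only [Complex.norm_exp]
  congr 1
  rw [show (-(1 / 16 : ℂ) * ((‖x‖ : ℂ)) ^ 2) = (((-(‖x‖ ^ 2 / 16) : ℝ)) : ℂ) by push_cast; ring]
  exact Complex.ofReal_re _

/-- The product Gaussian `exp(−Σ_μ‖c_μ‖²/16)` is integrable on the block. [folklore] -/
theorem integrable_exp_neg_normSum_sixteenth (k : ℕ) :
    Integrable fun c : Fin k → EuclideanSpace ℝ (Fin 3) => Real.exp (-((∑ μ, ‖c μ‖ ^ 2) / 16)) := by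
  have h := Integrable.fintype_prod (ι := Fin k) (μ := fun _ => (volume : Measure (EuclideanSpace ℝ (Fin 3))))
    (f := fun _ x => Real.exp (-(‖x‖ ^ 2 / 16))) (fun _ => integrable_exp_neg_normSq_sixteenth)
  refine h.congr (Filter.Eventually.of_forall fun c => ?_)
  simp only
  rw [← Real.exp_sum]
  congr 1
  rw [Finset.sum_div, ← Finset.sum_neg_distrib]

/-- `Q_k(c) ≥ 0` and `Σ‖c_μ‖² ≥ 0` packaged: the derivative factor `4βt³Q + tS` is nonnegative for `β ≥ 0`, `t ≥ 0`. [folklore] -/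
theorem derivFactor_nonneg (k : ℕ) {β t : ℝ} (hβ : 0 ≤ β) (ht : 0 ≤ t) (c : Fin k → EuclideanSpace ℝ (Fin 3)) :
    0 ≤ 4 * β * t ^ 3 * zeroModeQuartic k c + t * ∑ μ, ‖c μ‖ ^ 2 := by
  have hQ := quartic_nonneg k c
  have hS : 0 ≤ ∑ μ, ‖c μ‖ ^ 2 := Finset.sum_nonneg fun μ _ => by positivity
  positivity

/-- ★ THE DOMINATION: for `β ≥ 0` and `t ∈ (1/2, 3/2)`,
`(4βt³Q + tS)·exp(−βt⁴Q − t²S/2) ≤ 32·exp(−S/16)` (`S = Σ‖c_μ‖²`). [folklore] -/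
theorem derivFactor_mul_exp_le (k : ℕ) {β t : ℝ} (hβ : 0 ≤ β) (ht1 : 1 / 2 < t) (ht2 : t < 3 / 2)
    (c : Fin k → EuclideanSpace ℝ (Fin 3)) :
    (4 * β * t ^ 3 * zeroModeQuartic k c + t * ∑ μ, ‖c μ‖ ^ 2) *
        Real.exp (-β * (t ^ 4 * zeroModeQuartic k c) - t ^ 2 * (∑ μ, ‖c μ‖ ^ 2) / 2) ≤
      32 * Real.exp (-((∑ μ, ‖c μ‖ ^ 2) / 16)) := by
  set Q := zeroModeQuartic k c with hQdef
  set S := ∑ μ, ‖c μ‖ ^ 2 with hSdef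
  have hQ : 0 ≤ Q := quartic_nonneg k c
  have hS : 0 ≤ S := Finset.sum_nonneg fun μ _ => by positivity
  have ht : 0 < t := by linarith
  -- split the exponential
  have hsplit : Real.exp (-β * (t ^ 4 * Q) - t ^ 2 * S / 2) = Real.exp (-(β * t ^ 4 * Q)) * Real.exp (-(t ^ 2 * S / 2)) := by
    rw [← Real.exp_add]; congr 1; ring
  have hA : 0 ≤ β * t ^ 4 * Q := by positivity
  have hE1 : Real.exp (-(β * t ^ 4 * Q)) ≤ 1 := by
    rw [Real.exp_le_one_iff]; linarith
  have hE2 : Real.exp (-(t ^ 2 * S / 2)) ≤ Real.exp (-(S / 8)) := by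
    rw [Real.exp_le_exp]
    have ht2' : 1 / 4 ≤ t ^ 2 := by nlinarith
    have : S / 8 ≤ t ^ 2 * S / 2 := by nlinarith [mul_nonneg (sub_nonneg.2 ht2') hS]
    linarith
  have hE3 : Real.exp (-(S / 8)) ≤ Real.exp (-(S / 16)) := by
    rw [Real.exp_le_exp]; linarith
  have hpos1 : 0 < Real.exp (-(t ^ 2 * S / 2)) := Real.exp_pos _
  have hpos2 : 0 < Real.exp (-(β * t ^ 4 * Q)) := Real.exp_pos _
  -- first term: `4βt³Q·e^{−βt⁴Q} = (4/t)·(βt⁴Q·e^{−βt⁴Q}) ≤ 4/t < 8`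
  have hT1 : 4 * β * t ^ 3 * Q * Real.exp (-(β * t ^ 4 * Q)) ≤ 8 := by
    have h1 : β * t ^ 4 * Q * Real.exp (-(β * t ^ 4 * Q)) ≤ 1 := by
      have a := Real.add_one_le_exp (β * t ^ 4 * Q)
      rw [Real.exp_neg, mul_inv_le_iff₀ (Real.exp_pos _)]
      linarith
    have h2 : 4 * β * t ^ 3 * Q * Real.exp (-(β * t ^ 4 * Q)) = (4 / t) * (β * t ^ 4 * Q * Real.exp (-(β * t ^ 4 * Q))) := by
      rw [div_mul_eq_mul_div, eq_div_iff ht.ne']; ring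
    rw [h2]
    have h3 : 4 / t ≤ 8 := by rw [div_le_iff₀ ht]; linarith
    have h4 : 0 ≤ 4 / t := by positivity
    calc (4 / t) * (β * t ^ 4 * Q * Real.exp (-(β * t ^ 4 * Q))) ≤ (4 / t) * 1 := by gcongr
      _ ≤ 8 := by linarith
  -- second term: `tS·e^{−t²S/2} ≤ (3/2)·S·e^{−S/8} ≤ 24·e^{−S/16}`
  have hT2 : t * S * Real.exp (-(t ^ 2 * S / 2)) ≤ 24 * Real.exp (-(S / 16)) := by
    have h1 := mul_exp_neg_div_eight_le S
    have h2 : t * S * Real.exp (-(t ^ 2 * S / 2)) ≤ t * S * Real.exp (-(S / 8)) := by gcongr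
    have h3 : t * S * Real.exp (-(S / 8)) = t * (S * Real.exp (-(S / 8))) := by ring
    nlinarith [h1, h2, Real.exp_pos (-(S / 16))]
  -- assemble
  rw [hsplit]
  have hL : (4 * β * t ^ 3 * Q + t * S) * (Real.exp (-(β * t ^ 4 * Q)) * Real.exp (-(t ^ 2 * S / 2))) =
      (4 * β * t ^ 3 * Q * Real.exp (-(β * t ^ 4 * Q))) * Real.exp (-(t ^ 2 * S / 2)) +
        (t * S * Real.exp (-(t ^ 2 * S / 2))) * Real.exp (-(β * t ^ 4 * Q)) := by ring
  rw [hL]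
  have hB1 : (4 * β * t ^ 3 * Q * Real.exp (-(β * t ^ 4 * Q))) * Real.exp (-(t ^ 2 * S / 2)) ≤ 8 * Real.exp (-(S / 16)) := by
    calc (4 * β * t ^ 3 * Q * Real.exp (-(β * t ^ 4 * Q))) * Real.exp (-(t ^ 2 * S / 2))
        ≤ 8 * Real.exp (-(t ^ 2 * S / 2)) := by gcongr
      _ ≤ 8 * Real.exp (-(S / 16)) := mul_le_mul_of_nonneg_left (hE2.trans hE3) (by norm_num)
  have hB2 : (t * S * Real.exp (-(t ^ 2 * S / 2))) * Real.exp (-(β * t ^ 4 * Q)) ≤ 24 * Real.exp (-(S / 16)) := by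
    have h0 : 0 ≤ t * S * Real.exp (-(t ^ 2 * S / 2)) := by positivity
    calc (t * S * Real.exp (-(t ^ 2 * S / 2))) * Real.exp (-(β * t ^ 4 * Q))
        ≤ (t * S * Real.exp (-(t ^ 2 * S / 2))) * 1 := by gcongr
      _ ≤ 24 * Real.exp (-(S / 16)) := by linarith
  linarith

/-! ## §4 Differentiation under the integral sign along the scaling -/

/-- The `t`-derivative of the scaled integrand: `d/dt exp(−βt⁴Q − t²S/2) = −(4βt³Q + tS)·exp(−βt⁴Q − t²S/2)`. [folklore] -/
theorem hasDerivAt_scaledIntegrand (k : ℕ) (β t : ℝ) (c : Fin k → EuclideanSpace ℝ (Fin 3)) :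
    HasDerivAt (fun s : ℝ => Real.exp (-β * (s ^ 4 * zeroModeQuartic k c) - s ^ 2 * (∑ μ, ‖c μ‖ ^ 2) / 2))
      (-(4 * β * t ^ 3 * zeroModeQuartic k c + t * ∑ μ, ‖c μ‖ ^ 2) *
        Real.exp (-β * (t ^ 4 * zeroModeQuartic k c) - t ^ 2 * (∑ μ, ‖c μ‖ ^ 2) / 2)) t := by
  set Q := zeroModeQuartic k c
  set S := ∑ μ, ‖c μ‖ ^ 2
  have h4 : HasDerivAt (fun s : ℝ => s ^ 4) (4 * t ^ 3) t := by
    simpa using hasDerivAt_pow 4 t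
  have h2 : HasDerivAt (fun s : ℝ => s ^ 2) (2 * t) t := by
    simpa using hasDerivAt_pow 2 t
  have hg : HasDerivAt (fun s : ℝ => -β * (s ^ 4 * Q) - s ^ 2 * S / 2)
      (-β * (4 * t ^ 3 * Q) - 2 * t * S / 2) t := by
    have a := (h4.mul_const Q).const_mul (-β)
    have b := (h2.mul_const S).div_const 2
    exact a.sub b
  have he := hg.exp
  refine he.congr_deriv ?_
  ring

/-- ★★ THE DERIVATIVE OF THE SCALED PARTITION FUNCTION at `t = 1`, computed under the integral sign:
`d/dt|_{t=1} ∫ exp(−βt⁴Q_k − t²S/2) dc = −∫ (4βQ_k + S)·zmI`, and the derivative integrand is integrable. [folklore] -/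
theorem hasDerivAt_integral_scaled (k : ℕ) {β : ℝ} (hβ : 0 ≤ β) :
    Integrable (fun c : Fin k → EuclideanSpace ℝ (Fin 3) =>
        -(4 * β * 1 ^ 3 * zeroModeQuartic k c + 1 * ∑ μ, ‖c μ‖ ^ 2) *
          Real.exp (-β * (1 ^ 4 * zeroModeQuartic k c) - 1 ^ 2 * (∑ μ, ‖c μ‖ ^ 2) / 2)) ∧
      HasDerivAt (fun t : ℝ => ∫ c : Fin k → EuclideanSpace ℝ (Fin 3),
          Real.exp (-β * (t ^ 4 * zeroModeQuartic k c) - t ^ 2 * (∑ μ, ‖c μ‖ ^ 2) / 2))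
        (∫ c : Fin k → EuclideanSpace ℝ (Fin 3),
          -(4 * β * 1 ^ 3 * zeroModeQuartic k c + 1 * ∑ μ, ‖c μ‖ ^ 2) *
            Real.exp (-β * (1 ^ 4 * zeroModeQuartic k c) - 1 ^ 2 * (∑ μ, ‖c μ‖ ^ 2) / 2)) 1 := by
  have hQc := continuous_quartic k
  have hSc : Continuous fun c : Fin k → EuclideanSpace ℝ (Fin 3) => ∑ μ, ‖c μ‖ ^ 2 := by fun_prop
  refine hasDerivAt_integral_of_dominated_loc_of_deriv_le (μ := (volume : Measure (Fin k → EuclideanSpace ℝ (Fin 3))))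
    (s := Set.Ioo (1 / 2 : ℝ) (3 / 2)) (x₀ := (1 : ℝ))
    (F := fun (t : ℝ) (c : Fin k → EuclideanSpace ℝ (Fin 3)) =>
      Real.exp (-β * (t ^ 4 * zeroModeQuartic k c) - t ^ 2 * (∑ μ, ‖c μ‖ ^ 2) / 2))
    (F' := fun (t : ℝ) (c : Fin k → EuclideanSpace ℝ (Fin 3)) =>
      -(4 * β * t ^ 3 * zeroModeQuartic k c + t * ∑ μ, ‖c μ‖ ^ 2) *
        Real.exp (-β * (t ^ 4 * zeroModeQuartic k c) - t ^ 2 * (∑ μ, ‖c μ‖ ^ 2) / 2))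
    (bound := fun c => 32 * Real.exp (-((∑ μ, ‖c μ‖ ^ 2) / 16)))
    (Ioo_mem_nhds (by norm_num) (by norm_num)) ?_ ?_ ?_ ?_ ?_ ?_
  · -- measurability of `F t` for every `t`
    refine Filter.Eventually.of_forall fun t => ?_
    exact (Continuous.aestronglyMeasurable (by fun_prop))
  · -- integrability of `F 1 = zmI k β`
    have h := integrable_zmI k hβ
    refine h.congr (Filter.Eventually.of_forall fun c => ?_)
    simp only [zmI, one_pow, one_mul]
  · -- measurability of `F' 1`
    exact (Continuous.aestronglyMeasurable (by fun_prop))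
  · -- the domination on `s`
    refine Filter.Eventually.of_forall fun c t ht => ?_
    have hnn := derivFactor_nonneg k hβ (by linarith [ht.1] : (0 : ℝ) ≤ t) c
    rw [norm_mul, norm_neg, Real.norm_eq_abs, Real.norm_eq_abs, abs_of_nonneg hnn, abs_of_pos (Real.exp_pos _)]
    exact derivFactor_mul_exp_le k hβ ht.1 ht.2 c
  · -- integrability of the bound
    exact (integrable_exp_neg_normSum_sixteenth k).const_mul 32
  · -- pointwise differentiability on `s`
    exact Filter.Eventually.of_forall fun c t _ => hasDerivAt_scaledIntegrand k β t c

/-! ## §5 ★★ The virial identity and its corollaries -/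

/-- ★★ **EULER ∕ VIRIAL IDENTITY OF THE ZERO-MODE BLOCK**: for every `k` and `β ≥ 0`,
`4β·∫ Q_k·zmI + ∫ (Σ_μ‖c_μ‖²)·zmI = 3k·Z_k(β)`. [folklore] -/
theorem zeroMode_virial (k : ℕ) {β : ℝ} (hβ : 0 ≤ β) :
    4 * β * (∫ c : Fin k → EuclideanSpace ℝ (Fin 3), zeroModeQuartic k c * zmI k β c) +
        ∫ c : Fin k → EuclideanSpace ℝ (Fin 3), (∑ μ, ‖c μ‖ ^ 2) * zmI k β c =
      3 * k * zeroModeZ k β := by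
  obtain ⟨hint, hder⟩ := hasDerivAt_integral_scaled k hβ
  -- the same function is `t ↦ t^{−3k}·Z` near `t = 1`
  have heq : (fun t : ℝ => ∫ c : Fin k → EuclideanSpace ℝ (Fin 3),
        Real.exp (-β * (t ^ 4 * zeroModeQuartic k c) - t ^ 2 * (∑ μ, ‖c μ‖ ^ 2) / 2)) =ᶠ[𝓝 1]
      fun t : ℝ => (t ^ (3 * k))⁻¹ * zeroModeZ k β := by
    filter_upwards [Ioi_mem_nhds (zero_lt_one' ℝ)] with t ht
    rw [← integral_zmI_smul k β ht]
    refine integral_congr_ae (Filter.Eventually.of_forall fun c => ?_)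
    exact (zmI_smul k β t c).symm
  have hpow : HasDerivAt (fun t : ℝ => (t ^ (3 * k))⁻¹ * zeroModeZ k β) (-(3 * k : ℝ) * zeroModeZ k β) 1 := by
    have h1 : HasDerivAt (fun t : ℝ => t ^ (3 * k)) ((3 * k : ℕ) * (1 : ℝ) ^ (3 * k - 1)) 1 := hasDerivAt_pow (3 * k) 1
    have h2 := h1.inv (by simp)
    have h3 := h2.mul_const (zeroModeZ k β)
    refine h3.congr_deriv ?_
    simp
  have hder' := hpow.congr_of_eventuallyEq heq
  have huniq := hder.unique hder'
  -- rewrite the derivative integrand as `−(4βQ + S)·zmI`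
  have hF'1 : ∀ c : Fin k → EuclideanSpace ℝ (Fin 3),
      -(4 * β * 1 ^ 3 * zeroModeQuartic k c + 1 * ∑ μ, ‖c μ‖ ^ 2) *
          Real.exp (-β * (1 ^ 4 * zeroModeQuartic k c) - 1 ^ 2 * (∑ μ, ‖c μ‖ ^ 2) / 2) =
        -((4 * β * zeroModeQuartic k c + ∑ μ, ‖c μ‖ ^ 2) * zmI k β c) := by
    intro c; simp only [zmI, one_pow, one_mul, mul_one, neg_mul]
  simp_rw [hF'1] at huniq hint
  rw [integral_neg] at huniq
  have hint' : Integrable (fun c : Fin k → EuclideanSpace ℝ (Fin 3) => (4 * β * zeroModeQuartic k c + ∑ μ, ‖c μ‖ ^ 2) * zmI k β c) := by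
    have := hint.neg; simpa using this
  -- split the integrable sum into its two nonnegative pieces
  have hnnQ : ∀ c : Fin k → EuclideanSpace ℝ (Fin 3), 0 ≤ 4 * β * zeroModeQuartic k c * zmI k β c := fun c =>
    mul_nonneg (by have := quartic_nonneg k c; positivity) (zmI_pos k β c).le
  have hnnS : ∀ c : Fin k → EuclideanSpace ℝ (Fin 3), 0 ≤ (∑ μ, ‖c μ‖ ^ 2) * zmI k β c := fun c =>
    mul_nonneg (Finset.sum_nonneg fun μ _ => by positivity) (zmI_pos k β c).le
  have hQc := continuous_quartic k
  have hzc := continuous_zmI k β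
  have hSc : Continuous fun c : Fin k → EuclideanSpace ℝ (Fin 3) => ∑ μ, ‖c μ‖ ^ 2 := by fun_prop
  have hintQ : Integrable (fun c : Fin k → EuclideanSpace ℝ (Fin 3) => 4 * β * zeroModeQuartic k c * zmI k β c) := by
    refine hint'.mono' (Continuous.aestronglyMeasurable (by fun_prop)) (Filter.Eventually.of_forall fun c => ?_)
    rw [Real.norm_eq_abs, abs_of_nonneg (hnnQ c)]
    nlinarith [hnnS c, hnnQ c]
  have hintS : Integrable (fun c : Fin k → EuclideanSpace ℝ (Fin 3) => (∑ μ, ‖c μ‖ ^ 2) * zmI k β c) := by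
    refine hint'.mono' (Continuous.aestronglyMeasurable (by fun_prop)) (Filter.Eventually.of_forall fun c => ?_)
    rw [Real.norm_eq_abs, abs_of_nonneg (hnnS c)]
    nlinarith [hnnS c, hnnQ c]
  have hsplit : ∫ c : Fin k → EuclideanSpace ℝ (Fin 3), (4 * β * zeroModeQuartic k c + ∑ μ, ‖c μ‖ ^ 2) * zmI k β c =
      4 * β * (∫ c : Fin k → EuclideanSpace ℝ (Fin 3), zeroModeQuartic k c * zmI k β c) +
        ∫ c : Fin k → EuclideanSpace ℝ (Fin 3), (∑ μ, ‖c μ‖ ^ 2) * zmI k β c := by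
    have e1 : ∀ c : Fin k → EuclideanSpace ℝ (Fin 3), (4 * β * zeroModeQuartic k c + ∑ μ, ‖c μ‖ ^ 2) * zmI k β c =
        4 * β * zeroModeQuartic k c * zmI k β c + (∑ μ, ‖c μ‖ ^ 2) * zmI k β c := fun c => by ring
    simp_rw [e1]
    rw [integral_add hintQ hintS]
    congr 1
    rw [← integral_const_mul]
    refine integral_congr_ae (Filter.Eventually.of_forall fun c => ?_)
    ring
  rw [hsplit] at huniq
  have hk : ((3 * k : ℕ) : ℝ) = 3 * (k : ℝ) := by push_cast; ring
  linarith [huniq]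

/-- `Z_k(β) > 0` for `β ≥ 0`. [folklore] -/
theorem zeroModeZ_pos (k : ℕ) {β : ℝ} (hβ : 0 ≤ β) : 0 < zeroModeZ k β := by
  rw [zeroModeZ_eq_integral]
  rw [integral_pos_iff_support_of_nonneg (fun c => (zmI_pos k β c).le) (integrable_zmI k hβ)]
  have hs : Function.support (zmI k β) = Set.univ := by
    ext c; simp [(zmI_pos k β c).ne']
  rw [hs]
  exact isOpen_univ.measure_pos volume Set.univ_nonempty

/-- ★ COROLLARY (virial softness of the block): `β·∫ Q_k·zmI ≤ (3k/4)·Z_k(β)`, i.e. `β⟨Q_k⟩_β ≤ 3k/4`. [folklore] -/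
theorem zeroMode_virial_le (k : ℕ) {β : ℝ} (hβ : 0 ≤ β) :
    β * ∫ c : Fin k → EuclideanSpace ℝ (Fin 3), zeroModeQuartic k c * zmI k β c ≤ 3 * k / 4 * zeroModeZ k β := by
  have h := zeroMode_virial k hβ
  have hS : 0 ≤ ∫ c : Fin k → EuclideanSpace ℝ (Fin 3), (∑ μ, ‖c μ‖ ^ 2) * zmI k β c :=
    integral_nonneg fun c => mul_nonneg (Finset.sum_nonneg fun μ _ => by positivity) (zmI_pos k β c).le
  linarith

/-- ★ THE PERIODIC BLOCK `k = 4`: `β·∫ Q₄·zmI ≤ 3·Z₄(β)` — the Gibbs mean of `βQ₄` on the central stratum's 12 zero modes is at most `3`,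
the Morse–Bott soft count `6·½` of a generic toron (cf. ✓`stub_rung_zeroModeLog4`: `Z₄ ∼ Aβ⁻³log β`, whose log is the `¼⟨Σ‖c_μ‖²⟩` deficit). [folklore] -/
theorem zeroMode_virial_four {β : ℝ} (hβ : 0 ≤ β) :
    β * ∫ c : Fin 4 → EuclideanSpace ℝ (Fin 3), zeroModeQuartic 4 c * zmI 4 β c ≤ 3 * zeroModeZ 4 β := by
  have h := zeroMode_virial_le 4 hβ
  norm_num at h
  exact h

/-- The mean form: `β·(∫ Q_k·zmI)/Z_k(β) ≤ 3k/4`. [folklore] -/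
theorem zeroMode_mean_le (k : ℕ) {β : ℝ} (hβ : 0 ≤ β) :
    β * (∫ c : Fin k → EuclideanSpace ℝ (Fin 3), zeroModeQuartic k c * zmI k β c) / zeroModeZ k β ≤ 3 * k / 4 := by
  have hZ := zeroModeZ_pos k hβ
  rw [div_le_iff₀ hZ]
  exact zeroMode_virial_le k hβ

end Summit.QuantumFields.YangMills.Theorems.ToronValleyVolume.ZeroMode

end
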